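import Summits.NavierStokesRegularity.NavierStokesRegularity.Theorems.SoloSalvageWu2026Annulus
import HarnessLib

/-!
# C177 `Wu2026` — TRUE column, Prop 3.4 (part 2/4): the inherited weak bounds (3.61) on dyadic
# annuli and local integrability of `|Q||V|` for an Euler blow-down tangent

D-0090 NS-CLAIMS sweep, claim C177 (W. Wu, arXiv:2608.22471v1), skeleton
`Literature/Claims/NS/Wu2026.lean` (typist-10 g6; rev 2 p560520); TRUE-column kernel objects for the
consumed binder `hP34` of `claim_of_steps''` — Proposition 3.4 p.22 l.3–8 (proof p.22 l.9 – p.23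
l.46) «For every τ > 0, F_τ = 0. (3.66) Moreover, ∫_{S_r} QV·n dS = 0 for almost every r > 0.
(3.67)», typed as `Step_P34` (companion laws `div(β(Q)V) = 0` in `D'({|y| > 1})` for all
`β ∈ C¹` with `β'` bounded ⟹ `ZeroRadialFlux (Ioi 1) T.V T.Q`). Records, not a verdict (row #164
lettered «discharges», RULINGS v1.51/v1.54); salvage-p1 g5 (DECONFLICT 20:19Z).

This file: the distribution-function bounds `T.weakBd` (3.61) read as weak-quasinorm bounds
`sup_t t^{9/2} μ_R{|V|>t} ≤ C`, `sup_t t^{9/4} μ_R{|Q|>t} ≤ C` for Lebesgue measure restricted to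
`A_R` (`Tangent.eWeakLpPow_annulus_le`), the resulting layer-cake bound
`∫_{A_R}|f|^r ≤ |A_R|λ^r + (r/(p−r))λ^{r−p}C` (`setLIntegral_annulus_rpow_le`, from the tree's
`MemWeakLp.setLIntegral_rpow_le`), and `|Q||V| ∈ L¹_loc(ℝ³ ∖ {0})` from `T.locInt` with `q₀ > 3`
(`Tangent.integrableOn_absQ_mul_normV`), with the radial-density integrability it implies
(`Tangent.integrable_radial_mul`).

WHAT THIS IS NOT: not a claim about NS regularity or blow-up; not a claim about any author beyond
the typed locator.
-/

noncomputable section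

set_option linter.dupNamespace false

open MeasureTheory Set Function Filter Topology Metric
open scoped ENNReal NNReal RealInnerProductSpace Topology

namespace Summit.NavierStokesRegularity.NavierStokesRegularity.Theorems.Wu2026Salvage

open Literature.Analysis.FluidPDE Literature.Analysis.FunctionSpaces Literature.Claims.NS.Wu2026

/-! ### The inherited weak bounds (3.61) as layer-cake input on dyadic annuli -/

section Weak

variable {ν : ℝ} {v : E3 → E3} {p : E3 → ℝ}


/-- The dyadic annulus is an open, hence measurable, set. [cite: Wu2026, A_R p.5 l.58] -/
theorem measurableSet_dyadicAnnulus (R : ℝ) : MeasurableSet (annulus R : Set E3) :=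
  ((isOpen_lt continuous_const continuous_norm).inter
    (isOpen_lt continuous_norm continuous_const)).measurableSet

/-- `T.Q = bern T.V T.P` unfolded. [cite: Wu2026, (3.38) p.14] -/
theorem Tangent.Q_apply (T : Tangent ν v p) (y : E3) : T.Q y = T.P y + ‖T.V y‖ ^ 2 / 2 := rfl

/-- `Q` and `V` are a.e.-strongly measurable. [cite: Wu2026, (3.28)/(3.45) p.11–16 (the limit pair)] -/
theorem Tangent.aestronglyMeasurable_Q (T : Tangent ν v p) : AEStronglyMeasurable T.Q volume := by
  have hV := T.locInt.1
  have hP := T.locInt.2.1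
  have h : T.Q = fun y => T.P y + ‖T.V y‖ ^ 2 / 2 := rfl
  rw [h]
  exact hP.add (((continuous_norm.pow 2).div_const 2).comp_aestronglyMeasurable hV)

/-- **(3.61) as a weak-quasinorm bound on each annulus**: with `μ_R` Lebesgue measure restricted to
`A_R`, `sup_t t^{9/2} μ_R{|V| > t} ≤ C` and `sup_t t^{9/4} μ_R{|Q| > t} ≤ C`, uniformly in
`R > 0`. [cite: Wu2026, (3.61) p.21 l.5–24] -/
theorem Tangent.eWeakLpPow_annulus_le (T : Tangent ν v p) :
    ∃ C : ℝ, 0 ≤ C ∧ ∀ R : ℝ, 0 < R →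
      eWeakLpPow T.V (ENNReal.ofReal (9 / 2)) (volume.restrict (annulus R)) ≤ ENNReal.ofReal C ∧
      eWeakLpPow T.Q (ENNReal.ofReal (9 / 4)) (volume.restrict (annulus R)) ≤ ENNReal.ofReal C := by
  obtain ⟨C, hC0, hC⟩ := T.weakBd
  refine ⟨C, hC0, fun R hR => ⟨?_, ?_⟩⟩
  · -- velocity
    refine iSup_le fun t => ?_
    rw [ENNReal.toReal_ofReal (by norm_num : (0 : ℝ) ≤ 9 / 2)]
    by_cases ht0 : t = 0
    · rw [ht0, ENNReal.coe_zero, ENNReal.zero_rpow_of_pos (by norm_num), zero_mul]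
      exact bot_le
    · have ht : 0 < t := pos_iff_ne_zero.2 ht0
      have ht' : (0 : ℝ) < (t : ℝ) := ht
      have hiff : ∀ y : E3, ((t : ℝ≥0∞) < ‖T.V y‖ₑ) ↔ ((t : ℝ) < ‖T.V y‖) := fun y => by
        rw [← ofReal_norm, ← ENNReal.ofReal_coe_nnreal, ENNReal.ofReal_lt_ofReal_iff_of_nonneg ht'.le]
      have hset : {x : E3 | (t : ℝ≥0∞) < ‖T.V x‖ₑ} ∩ annulus R = {y | y ∈ annulus R ∧ (t : ℝ) < ‖T.V y‖} := by
        ext y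
        simp only [mem_inter_iff, mem_setOf_eq, hiff]
        exact and_comm
      rw [Measure.restrict_apply' (measurableSet_dyadicAnnulus R), hset]
      have hfin : volume {y | y ∈ annulus R ∧ (t : ℝ) < ‖T.V y‖} ≠ ⊤ :=
        (measure_mono (fun y hy => hy.1) |>.trans_lt
          ((volume_annulus_le hR).trans_lt (ENNReal.mul_lt_top ENNReal.ofReal_lt_top measure_ball_lt_top))).ne
      have h1 := (hC R hR (t : ℝ) ht').1
      have h2 : volume {y | y ∈ annulus R ∧ (t : ℝ) < ‖T.V y‖} ≤
          ENNReal.ofReal (C * (t : ℝ) ^ (-((9 : ℝ) / 2))) :=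
        (ENNReal.le_ofReal_iff_toReal_le hfin (by positivity)).2 h1
      calc (t : ℝ≥0∞) ^ ((9 : ℝ) / 2) * volume {y | y ∈ annulus R ∧ (t : ℝ) < ‖T.V y‖}
          ≤ (t : ℝ≥0∞) ^ ((9 : ℝ) / 2) * ENNReal.ofReal (C * (t : ℝ) ^ (-((9 : ℝ) / 2))) :=
            mul_le_mul' le_rfl h2
        _ = ENNReal.ofReal C := by
            rw [← ENNReal.ofReal_coe_nnreal, ENNReal.ofReal_rpow_of_pos ht', ← ENNReal.ofReal_mul (by positivity),
              Real.rpow_neg ht'.le]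
            congr 1
            field_simp
  · -- Bernoulli function
    refine iSup_le fun t => ?_
    rw [ENNReal.toReal_ofReal (by norm_num : (0 : ℝ) ≤ 9 / 4)]
    by_cases ht0 : t = 0
    · rw [ht0, ENNReal.coe_zero, ENNReal.zero_rpow_of_pos (by norm_num), zero_mul]
      exact bot_le
    · have ht : 0 < t := pos_iff_ne_zero.2 ht0
      have ht' : (0 : ℝ) < (t : ℝ) := ht
      have hiff : ∀ y : E3, ((t : ℝ≥0∞) < ‖T.Q y‖ₑ) ↔ ((t : ℝ) < |bern T.V T.P y|) := fun y => by
        rw [← ofReal_norm, ← ENNReal.ofReal_coe_nnreal, ENNReal.ofReal_lt_ofReal_iff_of_nonneg ht'.le,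
          Real.norm_eq_abs]
        rfl
      have hset : {x : E3 | (t : ℝ≥0∞) < ‖T.Q x‖ₑ} ∩ annulus R =
          {y | y ∈ annulus R ∧ (t : ℝ) < |bern T.V T.P y|} := by
        ext y
        simp only [mem_inter_iff, mem_setOf_eq, hiff]
        exact and_comm
      rw [Measure.restrict_apply' (measurableSet_dyadicAnnulus R), hset]
      have hfin : volume {y | y ∈ annulus R ∧ (t : ℝ) < |bern T.V T.P y|} ≠ ⊤ :=
        (measure_mono (fun y hy => hy.1) |>.trans_lt
          ((volume_annulus_le hR).trans_lt (ENNReal.mul_lt_top ENNReal.ofReal_lt_top measure_ball_lt_top))).ne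
      have h1 := (hC R hR (t : ℝ) ht').2.1
      have h2 : volume {y | y ∈ annulus R ∧ (t : ℝ) < |bern T.V T.P y|} ≤
          ENNReal.ofReal (C * (t : ℝ) ^ (-((9 : ℝ) / 4))) :=
        (ENNReal.le_ofReal_iff_toReal_le hfin (by positivity)).2 h1
      calc (t : ℝ≥0∞) ^ ((9 : ℝ) / 4) * volume {y | y ∈ annulus R ∧ (t : ℝ) < |bern T.V T.P y|}
          ≤ (t : ℝ≥0∞) ^ ((9 : ℝ) / 4) * ENNReal.ofReal (C * (t : ℝ) ^ (-((9 : ℝ) / 4))) :=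
            mul_le_mul' le_rfl h2
        _ = ENNReal.ofReal C := by
            rw [← ENNReal.ofReal_coe_nnreal, ENNReal.ofReal_rpow_of_pos ht', ← ENNReal.ofReal_mul (by positivity),
              Real.rpow_neg ht'.le]
            congr 1
            field_simp

/-- **Layer cake on an annulus** (the tree's `MemWeakLp.setLIntegral_rpow_le` specialised to the
restricted measure `μ_R`): if `sup_t t^p μ_R{|f| > t} ≤ C` and `0 < r < p`, then for every height
`λ > 0`, `∫_{A_R} |f|^r ≤ |A_R| λ^r + (r/(p−r)) λ^{r−p} C`. [cite: Wu2026, (3.70)–(3.71) p.22–23] -/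
theorem setLIntegral_annulus_rpow_le {F : Type*} [NormedAddCommGroup F] {f : E3 → F} {R : ℝ}
    (hR : 0 < R) (hf : AEStronglyMeasurable f (volume.restrict (annulus R))) {p r : ℝ} (hr : 0 < r)
    (hrp : r < p) {C : ℝ} (hC : 0 ≤ C)
    (hW : eWeakLpPow f (ENNReal.ofReal p) (volume.restrict (annulus R)) ≤ ENNReal.ofReal C)
    {lam : ℝ} (hl : 0 < lam) :
    ∫⁻ x in annulus R, ‖f x‖ₑ ^ r ≤
      ENNReal.ofReal (8 * (volume (ball (0 : E3) 1)).toReal * R ^ 3 * lam ^ r +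
        r / (p - r) * lam ^ (r - p) * C) := by
  have hp0 : 0 ≤ p := hr.le.trans hrp.le
  have hrp' : r < (ENNReal.ofReal p).toReal := by rwa [ENNReal.toReal_ofReal hp0]
  have h := MemWeakLp.setLIntegral_rpow_le (μ := volume.restrict (annulus R)) (p := ENNReal.ofReal p)
    hf hr hrp' univ hl
  rw [Measure.restrict_univ, Measure.restrict_apply_univ, ENNReal.toReal_ofReal hp0] at h
  refine h.trans ?_
  have hV1 : volume (ball (0 : E3) 1) < ∞ := measure_ball_lt_top
  have hc0 : 0 ≤ r / (p - r) := div_nonneg hr.le (by linarith)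
  have h1 : volume (annulus R) * ENNReal.ofReal (lam ^ r) ≤
      ENNReal.ofReal (8 * (volume (ball (0 : E3) 1)).toReal * R ^ 3 * lam ^ r) := by
    calc volume (annulus R) * ENNReal.ofReal (lam ^ r)
        ≤ ENNReal.ofReal (8 * R ^ 3) * volume (ball (0 : E3) 1) * ENNReal.ofReal (lam ^ r) :=
          mul_le_mul' (volume_annulus_le hR) le_rfl
      _ = ENNReal.ofReal (8 * (volume (ball (0 : E3) 1)).toReal * R ^ 3 * lam ^ r) := by
          rw [← ENNReal.ofReal_toReal hV1.ne, ← ENNReal.ofReal_mul (by positivity),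
            ← ENNReal.ofReal_mul (by positivity), ENNReal.toReal_ofReal ENNReal.toReal_nonneg]
          congr 1
          ring
  have h2 : ENNReal.ofReal (r / (p - r) * lam ^ (r - p)) * eWeakLpPow f (ENNReal.ofReal p)
      (volume.restrict (annulus R)) ≤ ENNReal.ofReal (r / (p - r) * lam ^ (r - p) * C) := by
    calc ENNReal.ofReal (r / (p - r) * lam ^ (r - p)) * eWeakLpPow f (ENNReal.ofReal p)
          (volume.restrict (annulus R))
        ≤ ENNReal.ofReal (r / (p - r) * lam ^ (r - p)) * ENNReal.ofReal C := mul_le_mul' le_rfl hW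
      _ = ENNReal.ofReal (r / (p - r) * lam ^ (r - p) * C) := by
          rw [← ENNReal.ofReal_mul (mul_nonneg hc0 (Real.rpow_pos_of_pos hl _).le)]
  calc volume (annulus R) * ENNReal.ofReal (lam ^ r) +
        ENNReal.ofReal (r / (p - r) * lam ^ (r - p)) * eWeakLpPow f (ENNReal.ofReal p)
          (volume.restrict (annulus R))
      ≤ _ := add_le_add h1 h2
    _ = _ := by
        rw [← ENNReal.ofReal_add (by positivity)
          (mul_nonneg (mul_nonneg hc0 (Real.rpow_pos_of_pos hl _).le) hC)]

end Weak


/-! ### Local integrability of `|Q||V|` on compact sets avoiding the origin -/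

/-- `x^s ≤ 1 + x^t` for `x ≥ 0` and `0 ≤ s ≤ t`. [folklore] -/
theorem rpow_le_one_add_rpow {x s t : ℝ} (hx : 0 ≤ x) (hs : 0 ≤ s) (hst : s ≤ t) :
    x ^ s ≤ 1 + x ^ t := by
  have ht0 : 0 ≤ x ^ t := Real.rpow_nonneg hx t
  rcases le_or_gt x 1 with h | h
  · exact (Real.rpow_le_one hx h hs).trans (by linarith)
  · exact (Real.rpow_le_rpow_of_exponent_le h.le hst).trans (by linarith)

/-- `|P|·|V| ≤ |P|^{3/2} + |V|³` for reals `P` and norms `|V| ≥ 0`. [folklore] -/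
theorem abs_mul_le_rpow_add_cube (P : ℝ) {a : ℝ} (ha : 0 ≤ a) :
    |P| * a ≤ |P| ^ ((3 : ℝ) / 2) + a ^ (3 : ℝ) := by
  have hP := abs_nonneg P
  have h3 : a ^ (3 : ℝ) = a ^ (3 : ℕ) := by
    rw [← Real.rpow_natCast]; norm_num
  rcases le_or_gt (a ^ 2) |P| with h | h
  · have ha' : a ≤ |P| ^ ((1 : ℝ) / 2) := by
      rw [← Real.sqrt_eq_rpow, ← Real.sqrt_sq ha]
      exact Real.sqrt_le_sqrt h
    calc |P| * a ≤ |P| * |P| ^ ((1 : ℝ) / 2) := mul_le_mul_of_nonneg_left ha' hP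
      _ = |P| ^ ((3 : ℝ) / 2) := by
          rw [← Real.rpow_one_add' hP (by norm_num)]; norm_num
      _ ≤ |P| ^ ((3 : ℝ) / 2) + a ^ (3 : ℝ) := le_add_of_nonneg_right (Real.rpow_nonneg ha _)
  · calc |P| * a ≤ a ^ 2 * a := mul_le_mul_of_nonneg_right h.le ha
      _ = a ^ (3 : ℝ) := by rw [h3]; ring
      _ ≤ |P| ^ ((3 : ℝ) / 2) + a ^ (3 : ℝ) := le_add_of_nonneg_left (Real.rpow_nonneg hP _)

section LocInt

variable {ν : ℝ} {v : E3 → E3} {p : E3 → ℝ}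

/-- **`|Q||V| ∈ L¹_loc(ℝ³ ∖ {0})`** for an Euler blow-down tangent: on a compact `K ⊆ ℝ³ ∖ {0}`,
`|Q||V| ≤ |P||V| + |V|³ ≤ 1 + |P|^{q₀/2} + 2(1 + |V|^{q₀})` with `q₀ > 3`, and the right side is
integrable on `K` by `T.locInt` ((3.28), (3.45): `V ∈ L^{q₀}_loc`, `P ∈ L^{q₀/2}_loc`).
[cite: Wu2026, (3.28) p.11 l.44–50 and (3.45) p.16 l.21–27] -/
theorem Tangent.integrableOn_absQ_mul_normV (T : Tangent ν v p) {K : Set E3} (hK : IsCompact K)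
    (hKp : K ⊆ punctured) : IntegrableOn (fun y => |T.Q y| * ‖T.V y‖) K := by
  obtain ⟨hVm, hPm, hloc⟩ := T.locInt
  obtain ⟨hIV, hIP⟩ := hloc K hK hKp
  have hq3 : 3 < T.q0 := T.hq0.1
  have hKfin : volume K < ∞ := hK.measure_lt_top
  -- the dominating function
  set G : E3 → ℝ := fun y => (1 + |T.P y| ^ (T.q0 / 2)) + 2 * (1 + ‖T.V y‖ ^ T.q0) with hG
  have hGi : IntegrableOn G K := by
    have h1 : IntegrableOn (fun _ : E3 => (1 : ℝ)) K := integrableOn_const hKfin.ne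
    exact (h1.add hIP).add ((h1.add hIV).const_mul 2)
  have hmeas : AEStronglyMeasurable (fun y => |T.Q y| * ‖T.V y‖) (volume.restrict K) :=
    ((continuous_abs.comp_aestronglyMeasurable (Tangent.aestronglyMeasurable_Q T)).mul hVm.norm).restrict
  refine Integrable.mono' hGi hmeas (ae_of_all _ fun y => ?_)
  rw [Real.norm_eq_abs, abs_of_nonneg (mul_nonneg (abs_nonneg _) (norm_nonneg _))]
  have hVn := norm_nonneg (T.V y)
  have hPa := abs_nonneg (T.P y)
  -- `|Q| ≤ |P| + |V|²/2`
  have hQ : |T.Q y| ≤ |T.P y| + ‖T.V y‖ ^ 2 / 2 := by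
    rw [Tangent.Q_apply]
    calc |T.P y + ‖T.V y‖ ^ 2 / 2| ≤ |T.P y| + |‖T.V y‖ ^ 2 / 2| := abs_add_le _ _
      _ = |T.P y| + ‖T.V y‖ ^ 2 / 2 := by
          rw [abs_of_nonneg (by positivity : (0 : ℝ) ≤ ‖T.V y‖ ^ 2 / 2)]
  have h3 : ‖T.V y‖ ^ (3 : ℝ) = ‖T.V y‖ ^ (3 : ℕ) := by
    rw [← Real.rpow_natCast]; norm_num
  have hcube : ‖T.V y‖ ^ (3 : ℝ) ≤ 1 + ‖T.V y‖ ^ T.q0 :=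
    rpow_le_one_add_rpow hVn (by norm_num) hq3.le
  have h32 : |T.P y| ^ ((3 : ℝ) / 2) ≤ 1 + |T.P y| ^ (T.q0 / 2) :=
    rpow_le_one_add_rpow hPa (by norm_num) (by linarith)
  calc |T.Q y| * ‖T.V y‖ ≤ (|T.P y| + ‖T.V y‖ ^ 2 / 2) * ‖T.V y‖ :=
        mul_le_mul_of_nonneg_right hQ hVn
    _ = |T.P y| * ‖T.V y‖ + ‖T.V y‖ ^ (3 : ℕ) / 2 := by ring
    _ ≤ (|T.P y| ^ ((3 : ℝ) / 2) + ‖T.V y‖ ^ (3 : ℝ)) + ‖T.V y‖ ^ (3 : ℝ) := by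
        rw [h3]
        have : ‖T.V y‖ ^ (3 : ℕ) / 2 ≤ ‖T.V y‖ ^ (3 : ℕ) := by
          have : 0 ≤ ‖T.V y‖ ^ (3 : ℕ) := by positivity
          linarith
        exact add_le_add (by rw [← h3]; exact abs_mul_le_rpow_add_cube _ hVn) this
    _ ≤ G y := by rw [hG]; linarith

/-- `|β(Q) V·y/|y|| ≤ |Q||V|` when `|β(z)| ≤ |z|`. [folklore] -/
theorem abs_flux_le {β : ℝ → ℝ} (hβ : ∀ z, |β z| ≤ |z|) (Q : ℝ) (V y : E3) :
    |β Q * ⟪V, y⟫ / ‖y‖| ≤ |Q| * ‖V‖ := by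
  rw [abs_div, abs_mul, abs_norm]
  by_cases hy0 : ‖y‖ = 0
  · rw [hy0, div_zero]; exact mul_nonneg (abs_nonneg _) (norm_nonneg _)
  · rw [div_le_iff₀ (lt_of_le_of_ne (norm_nonneg _) (Ne.symm hy0))]
    calc |β Q| * |⟪V, y⟫| ≤ |Q| * (‖V‖ * ‖y‖) :=
          mul_le_mul (hβ _) (abs_real_inner_le_norm _ _) (abs_nonneg _) (abs_nonneg _)
      _ = |Q| * ‖V‖ * ‖y‖ := by ring

/-- The flux density `β(Q) V·y/|y|` is a.e.-strongly measurable for continuous `β`. [folklore] -/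
theorem Tangent.aestronglyMeasurable_flux (T : Tangent ν v p) {β : ℝ → ℝ} (hβc : Continuous β) :
    AEStronglyMeasurable (fun y : E3 => β (T.Q y) * ⟪T.V y, y⟫ / ‖y‖) volume := by
  obtain ⟨hVm, -, -⟩ := T.locInt
  have h : AEMeasurable (fun y : E3 => β (T.Q y) * ⟪T.V y, y⟫ / ‖y‖) volume :=
    ((hβc.measurable.comp_aemeasurable (Tangent.aestronglyMeasurable_Q T).aemeasurable).mul
      (hVm.aemeasurable.inner aemeasurable_id)).div continuous_norm.measurable.aemeasurable
  exact h.aestronglyMeasurable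

/-- **Integrability of radially cut-off densities.** For a continuous profile `f` vanishing off
`[a, b]` with `a > 0` and an a.e.-strongly measurable `F` with `|F| ≤ |Q||V|`, the density
`f(|y|) F(y)` is integrable on `ℝ³` (it lives on the compact shell `a ≤ |y| ≤ b` avoiding the
origin, where `|Q||V|` is integrable). [cite: Wu2026, (3.58)–(3.59) p.19 l.95–107] -/
theorem Tangent.integrable_radial_mul (T : Tangent ν v p) {f : ℝ → ℝ} (hf : Continuous f)
    {a b : ℝ} (ha : 0 < a) (hzero : ∀ r, r ∉ Icc a b → f r = 0) {F : E3 → ℝ}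
    (hFm : AEStronglyMeasurable F volume) (hFle : ∀ y, |F y| ≤ |T.Q y| * ‖T.V y‖) :
    Integrable (fun y : E3 => f ‖y‖ * F y) := by
  set Sh : Set E3 := {y | a ≤ ‖y‖ ∧ ‖y‖ ≤ b} with hSh
  have hShc : IsClosed Sh :=
    (isClosed_le continuous_const continuous_norm).inter (isClosed_le continuous_norm continuous_const)
  have hShK : IsCompact Sh :=
    (isCompact_closedBall (0 : E3) b).of_isClosed_subset hShc fun y hy =>
      mem_closedBall_zero_iff.2 hy.2
  have hShp : Sh ⊆ punctured := fun y hy => by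
    intro h0
    have : ‖y‖ = 0 := by rw [show y = 0 from h0, norm_zero]
    linarith [hy.1]
  have hI := Tangent.integrableOn_absQ_mul_normV T hShK hShp
  obtain ⟨C, hC⟩ := hf.bounded_above_of_compact_support (HasCompactSupport.intro isCompact_Icc hzero)
  have hC0 : 0 ≤ C := (norm_nonneg _).trans (hC 0)
  have hmeas : AEStronglyMeasurable (fun y : E3 => f ‖y‖ * F y) volume :=
    (hf.comp continuous_norm).aestronglyMeasurable.mul hFm
  refine Integrable.mono' ((hI.integrable_indicator hShc.measurableSet).const_mul C) hmeas
    (ae_of_all _ fun y => ?_)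
  by_cases hy : y ∈ Sh
  · rw [indicator_of_mem hy, Real.norm_eq_abs, abs_mul]
    refine mul_le_mul ?_ (hFle y) (abs_nonneg _) hC0
    have := hC ‖y‖; rwa [Real.norm_eq_abs] at this
  · have hr : ‖y‖ ∉ Icc a b := fun h => hy ⟨h.1, h.2⟩
    rw [hzero _ hr, zero_mul, norm_zero, indicator_of_notMem hy, mul_zero]

end LocInt

end Summit.NavierStokesRegularity.NavierStokesRegularity.Theorems.Wu2026Salvage
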